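import Mathlib

/-!
# Stub `stub_ratSpannedInf` (line `middle-involution-purity` of crux
# `EndoscopicMiddleDegree.OrthogonalEnveloped`, stmt-HodgeConjecture-14300): intersections of
# ℚ-spanned subspaces of `ℂ^N` are ℚ-spanned

Registered skeleton: line `middle-involution-purity` of crux `OrthogonalEnveloped`; this is the file
`Theorems/EndoscopicMiddleDegreeOrthogonalEnvelopedRatSpannedInf.lean` of the summit
(`--supports stmt-HodgeConjecture-14300`). Pure Mathlib linear algebra.

WHAT IS PROVED. Call a subspace `W ≤ ℂ^N` ℚ-spanned if it is contained in the `ℂ`-span of its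
rational points `{c ∈ W | c = cast ∘ q, q ∈ ℚ^N}`. If `W₁` and `W₂` are ℚ-spanned, so is `W₁ ⊓ W₂`
(`stub_ratSpannedInf`).

PROOF. Fix a Hamel basis `B = Module.Basis.ofVectorSpace ℚ ℂ` of `ℂ` over `ℚ` and, for a basis index `s`,
the coordinatewise `s`-th Hamel coordinate `π_s : ℂ^N → ℚ^N`, `π_s x = (B.repr (x i) s)_i`; it is
`ℚ`-linear and `π_s (a • cast q) = (B.repr a s) • q` for `a ∈ ℂ`, `q ∈ ℚ^N`
(`ratInf_reprCast_smul_ratCast`). Hence, for a ℚ-spanned `W`, every `x ∈ W` (a `ℂ`-combination of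
rational vectors of `W`) has `cast (π_s x) ∈ W` for all `s` (`ratInf_reprCast_mem`, by span induction
on the strengthened predicate `∀ a, cast (π_s (a • x)) ∈ W`). Finally every `x ∈ ℂ^N` is the finite
sum `x = Σ_s B s • cast (π_s x)` (`ratInf_exists_eq_sum_reprCast`); for `x ∈ W₁ ⊓ W₂` each
`cast (π_s x)` is a rational vector of `W₁ ⊓ W₂`, so `x` lies in their `ℂ`-span.
-/

noncomputable section

-- The crux-workfile namespace `Summit.<P>.<Sub>.Cruxes.…` repeats `HodgeConjecture` (single-conjunct summit).
set_option linter.dupNamespace false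

namespace Summit.HodgeConjecture.HodgeConjecture.Cruxes.OrthogonalEnveloped.MiddleInvolutionPurity

open scoped BigOperators

/-! ## Helper lemmas (worker): coordinatewise Hamel coordinates of vectors of `ℂ^N` -/

/-- **Hamel coordinates of a complex multiple of a rational vector.** For the Hamel basis
`B = Module.Basis.ofVectorSpace ℚ ℂ`, a basis index `s`, `a ∈ ℂ` and `q ∈ ℚ^N`, the coordinatewise `s`-th
Hamel coordinate of `a • cast q`, cast back into `ℂ^N`, is `(B.repr a s) • cast q` (because
`B.repr (a * q i) s = q i * B.repr a s` by `ℚ`-linearity of `B.repr`). [folklore] -/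
theorem ratInf_reprCast_smul_ratCast (N : ℕ) (s : Module.Basis.ofVectorSpaceIndex ℚ ℂ) (a : ℂ)
    (q : Fin N → ℚ) :
    (fun i ↦ (((Module.Basis.ofVectorSpace ℚ ℂ).repr ((a • fun j ↦ (q j : ℂ)) i) s : ℚ) : ℂ)) =
      (((Module.Basis.ofVectorSpace ℚ ℂ).repr a s : ℚ) : ℂ) • fun i ↦ (q i : ℂ) := by
  funext i
  simp only [Pi.smul_apply, smul_eq_mul]
  have h : a * (q i : ℂ) = (q i : ℚ) • a := by rw [Rat.smul_def, mul_comm]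
  rw [h, map_smul, Finsupp.smul_apply, smul_eq_mul, Rat.cast_mul]
  exact mul_comm _ _

set_option maxHeartbeats 400000 in
/-- **Hamel coordinates of a ℚ-spanned subspace stay in it.** If `W ≤ ℂ^N` is contained in the
`ℂ`-span of its rational vectors, then for every `x ∈ W` and every Hamel-basis index `s` the
rational vector `(B.repr (x i) s)_i`, cast into `ℂ^N`, lies in `W`. Proof: span induction on
`x`, for the predicate `∀ a : ℂ, cast (π_s (a • x)) ∈ W` (closed under `+` by `ℚ`-linearity of
`B.repr`, under `b • -` trivially, true on rational generators by
`ratInf_reprCast_smul_ratCast`), then `a = 1`. [folklore] -/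
theorem ratInf_reprCast_mem {N : ℕ} {W : Submodule ℂ (Fin N → ℂ)}
    (hW : W ≤ Submodule.span ℂ {c : Fin N → ℂ | c ∈ W ∧ ∃ q : Fin N → ℚ, c = fun i ↦ (q i : ℂ)})
    {x : Fin N → ℂ} (hx : x ∈ W) (s : Module.Basis.ofVectorSpaceIndex ℚ ℂ) :
    (fun i ↦ (((Module.Basis.ofVectorSpace ℚ ℂ).repr (x i) s : ℚ) : ℂ)) ∈ W := by
  -- strengthen to all complex multiples `a • x`, then take `a = 1`
  suffices h : ∀ a : ℂ,
      (fun i ↦ (((Module.Basis.ofVectorSpace ℚ ℂ).repr ((a • x) i) s : ℚ) : ℂ)) ∈ W by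
    simpa only [one_smul] using h 1
  refine Submodule.span_induction
    (p := fun y _ ↦ ∀ a : ℂ, (fun i ↦ (((Module.Basis.ofVectorSpace ℚ ℂ).repr ((a • y) i) s : ℚ) : ℂ)) ∈ W)
    ?_ ?_ ?_ ?_ (hW hx)
  · rintro _ ⟨hc, q, rfl⟩ a
    rw [ratInf_reprCast_smul_ratCast]
    exact W.smul_mem _ hc
  · intro a
    convert W.zero_mem using 1
    funext i
    simp
  · intro y z _ _ hy hz a
    convert W.add_mem (hy a) (hz a) using 1
    funext i
    simp only [Pi.smul_apply, Pi.add_apply, smul_eq_mul]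
    rw [mul_add, map_add, Finsupp.add_apply, Rat.cast_add]
  · intro b y _ hy a
    simpa only [smul_smul] using hy (a * b)

/-- **Reconstruction from Hamel coordinates.** Every `x ∈ ℂ^N` is the finite sum
`x = Σ_{s ∈ T} B s • cast (π_s x)` of its coordinatewise Hamel coordinate vectors weighted by the
Hamel basis `B = Module.Basis.ofVectorSpace ℚ ℂ`, over any finite set `T` of indices containing the
supports of all `B.repr (x i)` (here their union). Coordinatewise this is
`x i = Σ_s (B.repr (x i) s) • B s` (`Basis.linearCombination_repr`). [folklore] -/
theorem ratInf_exists_eq_sum_reprCast (N : ℕ) (x : Fin N → ℂ) :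
    ∃ T : Finset (Module.Basis.ofVectorSpaceIndex ℚ ℂ),
      x = ∑ s ∈ T, (Module.Basis.ofVectorSpace ℚ ℂ s) •
        fun i ↦ (((Module.Basis.ofVectorSpace ℚ ℂ).repr (x i) s : ℚ) : ℂ) := by
  classical
  set B := Module.Basis.ofVectorSpace ℚ ℂ
  refine ⟨Finset.univ.biUnion fun i ↦ (B.repr (x i)).support, ?_⟩
  funext i
  rw [Finset.sum_apply]
  simp only [Pi.smul_apply, smul_eq_mul]
  have hsub : (B.repr (x i)).support ⊆ Finset.univ.biUnion fun j ↦ (B.repr (x j)).support :=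
    Finset.subset_biUnion_of_mem (fun j ↦ (B.repr (x j)).support) (Finset.mem_univ i)
  conv_lhs => rw [← B.linearCombination_repr (x i), Finsupp.linearCombination_apply,
    Finsupp.sum_of_support_subset _ hsub _ (fun s _ ↦ zero_smul ℚ (B s))]
  refine Finset.sum_congr rfl fun s _ ↦ ?_
  rw [Rat.smul_def, mul_comm]

/-- **Stub 4b — INTERSECTIONS OF ℚ-SPANNED SUBSPACES OF `ℂ^N` ARE ℚ-SPANNED (Mathlib-only linear
algebra).** A subspace `W ≤ ℂ^N` is ℚ-spanned if it is contained in (hence equal to) the `ℂ`-span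
of its rational points `W ∩ ℚ^N`. If `W₁`, `W₂` are ℚ-spanned, so is `W₁ ⊓ W₂`. Proof: with a Hamel
basis `B` of `ℂ` over `ℚ`, `x = Σ_s B s • cast (π_s x)` (`ratInf_exists_eq_sum_reprCast`) and each
coordinatewise Hamel coordinate vector `cast (π_s x)` of `x ∈ W₁ ⊓ W₂` is a rational vector of `W₁`
and of `W₂` (`ratInf_reprCast_mem`). (Equivalently: the kernel of a ℚ-matrix over `ℂ` is spanned by
its kernel over `ℚ`.) [folklore] -/
theorem stub_ratSpannedInf :
    ∀ (N : ℕ) (W₁ W₂ : Submodule ℂ (Fin N → ℂ)),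
      W₁ ≤ Submodule.span ℂ {c : Fin N → ℂ | c ∈ W₁ ∧ ∃ q : Fin N → ℚ, c = fun i ↦ (q i : ℂ)} →
      W₂ ≤ Submodule.span ℂ {c : Fin N → ℂ | c ∈ W₂ ∧ ∃ q : Fin N → ℚ, c = fun i ↦ (q i : ℂ)} →
        W₁ ⊓ W₂ ≤ Submodule.span ℂ {c : Fin N → ℂ | c ∈ W₁ ⊓ W₂ ∧ ∃ q : Fin N → ℚ, c = fun i ↦ (q i : ℂ)} := by
  intro N W₁ W₂ h₁ h₂ x hx
  obtain ⟨T, hT⟩ := ratInf_exists_eq_sum_reprCast N x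
  rw [hT]
  refine Submodule.sum_mem _ fun s _ ↦ Submodule.smul_mem _ _ (Submodule.subset_span ?_)
  exact ⟨Submodule.mem_inf.mpr ⟨ratInf_reprCast_mem h₁ (Submodule.mem_inf.mp hx).1 s,
    ratInf_reprCast_mem h₂ (Submodule.mem_inf.mp hx).2 s⟩, _, rfl⟩

end Summit.HodgeConjecture.HodgeConjecture.Cruxes.OrthogonalEnveloped.MiddleInvolutionPurity

end
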